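import Summits.BirchSwinnertonDyer.Rank1Residual.Additive.KMCPerrinRiouDescentRankOne
import Summits.BirchSwinnertonDyer.Rank1Residual.Additive.QuadraticBranchOddStrictExactControl
import Summits.BirchSwinnertonDyer.Rank1Residual.Additive.QuadraticBranchValuationOfBSDp
import Summits.BirchSwinnertonDyer.Rank1Residual.Additive.StrictSelmerIndex
import HarnessLib

/-!
# ONE RESIDUE IN TWO CURRENCIES, rank one (planner's Q1 / R23 in kernel form): on a Gss2 pair with
# (12.5.2), GRANTED the two main conjectures (KMC⁰ on `W`, (C1_η) on the good twin) and the exact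
# control (C3_η), Perrin-Riou's PR^× and the η-branch `p`-adic Gross–Zagier valuation (C2_η-GZ =
# C-cc-1) are EQUIVALENT — both being equivalent to `BSD(W, p)` (cell `bsd-potss`, seat `kmc`,
# generation 2; part 7 of the descent files; theorems only, every input a hypothesis)

HONEST FRAMING (cell `bsd-potss`; memo `pub/bsd-potss/bsd-potss-kmc/KMC-DESCENT-MEMO-v2.md` §4b,
TARGET.md v2 §6.3 / R23): nothing asserted. The planner asked (Q1): is (C2_η-GZ) =
`QuadraticBranchPAdicGrossZagierValuationAt W p` ⟺ PR^×(`W`) modulo KMC⁰ / (C1_η) + kernel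
bookkeeping? ANSWER (this file): **YES, modulo BOTH main conjectures and (C3_η)** — by composing four
landed consumers: `rankOne_missingPPartAt_of_kmc_of_perrinRiou` (KMC⁰ ∧ PR^× ⇒ BSD_p, part 6) and
`perrinRiouUpToUnitAt_of_kmc_of_missingPPartAt` (KMC⁰ ∧ BSD_p ⇒ PR^×, part 6 = Burns–Kurihara–Sano
Thm. 7.3) on the Kato side; `bsdp_of_quadraticBranchPAdicGrossZagierValuation_of_exactControl`
((C1_η) ∧ (C2_η-GZ) ∧ (C3_η) ⇒ BSD_p, cc-typer-6 p307042) and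
`quadraticBranchPAdicGrossZagierValuationAt_of_bsdp` (BSD_p ∧ (C3_η) ∧ (C1_η) ⇒ (C2_η-GZ),
bsd-cm-inert p396720) on the signed side. So on the Gss2 rank-one rows with (12.5.2) the two
rank-one 'analytic' inputs PR^× (Burns–Kurihara–Sano Conj. 2.8 / 1.5 = Perrin-Riou 1993) and
C-cc-1 (OUR conjecture, EVIDENCE `conj:1-surviving`) carry the SAME open content once the main
conjectures are granted — "one residue in three currencies" (TARGET v2 §6.3) completed on the
rank-one side: {KMC⁰(W), C1_η(V)} × {PR^×(W), C2_η-GZ(W)} all give `BSD(W,p)`, and given the MC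
pair either analytic input gives the other. What it does NOT say: that PR^× ⟺ C2_η-GZ without the
main conjectures (no such statement is claimed or expected here: the dictionary "minus Coleman-map
derivative at the trivial zero `L⁻_η = X·L′`" of R23 is NOT formalised); nothing about CM rows
((12.5.2) fails; bsd-cm's O10 chain) or about any pair's `BSD`.

Binders DISPLAYED (all hypotheses): the split Kato readings (`RankOneCountReading`, `HasPRRatio`,
`Realizable`, `ReadsTrivialKMC`), GZK, modularity, Gross–Zagier I.(7.3) (`hGZ`, for `#Ш_an ∈ ℚ^×` in
the signed consumer), KMC⁰ (`hKMC`), (C1_η) on every good `a_p = 0` twin (`h1`), (C3_η) (`h3`), the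
non-vanishing of `coeff₁ L_p⁻(V,η,X)` on the data (`hne`, implied on paper by (C1_η) + the algebraic
side; displayed as in p396720), and the twin DATA of the signed consumer (`V, C, f, ϖ, L, P, n`: exist
on every Gss2 row — `L` by `exists_isQuadraticBranchMinusLFunction_of_isNewformOf` (ctrl p401120) —
displayed, not constructed). The elementary index `StrictSelmerIndexAt` is DISCHARGED
(`StrictSha.strictSelmerIndexAt_holds`).
References: Burns–Kurihara–Sano arXiv:1910.07404 Conj. 2.8, Thm. 7.3, Thm. 7.6 [BurnsKuriharaSano2019];
K. Kato, Astérisque 295 Conj. 12.10 [Kato2004Asterisque]; S. Kobayashi, Invent. Math. 152 (2003) §4,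
Thm. 7.4 [Kobayashi2003]; R. L. Miller, LMS JCM 14 (2011) Def. 1.1 [Miller2011LMS].
-/

set_option autoImplicit false

noncomputable section

open scoped Classical MatrixGroups ModularForm

open CongruenceSubgroup WeierstrassCurve Literature.NumberTheory.EllipticCurves
  Literature.NumberTheory.EllipticCurves.ModularForms
  Literature.NumberTheory.EllipticCurves.Kobayashi2003
  Literature.NumberTheory.EllipticCurves.Rank1Residual
  Literature.NumberTheory.EllipticCurves.Rank1Residual.Typed
  Literature.NumberTheory.EllipticCurves.IwasawaAlgebra

namespace Summit.BirchSwinnertonDyer.Rank1Residual.Additive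

variable {IsOf : ∀ (W : WeierstrassCurve ℚ) [W.IsElliptic] [W.IsGloballyMinimal] (p : ℕ) [Fact p.Prime],
  KatoDescentDatum p → Prop}
variable {PRRatio : ∀ (W : WeierstrassCurve ℚ) [W.IsElliptic] [W.IsGloballyMinimal] (p : ℕ)
  [Fact p.Prime], ℚ_[p] → Prop}
variable {KMC : ∀ (W : WeierstrassCurve ℚ) [W.IsElliptic] [W.IsGloballyMinimal] (p : ℕ), Prop}

variable (W : WeierstrassCurve ℚ) [W.IsElliptic] [W.IsGloballyMinimal] (p : ℕ) [Fact p.Prime]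
  {V : WeierstrassCurve ℚ} [V.IsElliptic] [V.IsGloballyMinimal] {C : VariableChange ℚ}
  {N : ℕ} [NeZero N] {f : CuspForm (Gamma0 N) 2} {ϖ : ℚ} {L : IwasawaAlgebra p}
  {P : W.toAffine.Point} {n : ℕ}

/-- **PR^× ⇒ C-cc-1 (valuation content), GRANTED KMC⁰(W), (C1_η) on the twins and (C3_η)**: PR^×
∧ KMC⁰ ⇒ `BSD(W,p)` (part 6) ⇒ `QuadraticBranchPAdicGrossZagierValuationAt W p` (p396720's converse
bookkeeping, with (C3_η), (C1_η) and the displayed non-vanishing of `coeff₁`). No twin data needed in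
this direction. [cite: BurnsKuriharaSano2019, Thm. 7.6 (p. 29)] [cite: Kobayashi2003, Thm. 7.4 (p. 13)] [cite: Miller2011LMS, Def. 1.1] -/
theorem quadraticBranchPAdicGrossZagierValuationAt_of_perrinRiou_of_kmc
    (hC : RankOneCountReading IsOf PRRatio) (hreal : Realizable IsOf) (hread : ReadsTrivialKMC IsOf KMC)
    (hGZK : rank_eq_analyticRank_of_analyticRank_le_one) (hmod : hasEntireLFunction_rat)
    (hr : W.analyticRank = 1) (hp : p ≠ 2) (hadd : Addv W p) (hj : 0 ≤ padicValRat p W.j)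
    (hK : Kato2004.ImageContainsSL2 W p) (hKMC : KMC W p)
    (h3 : QuadraticBranchOddStrictExactControlOfPlusMCAt W p)
    (h1 : ∀ (V : WeierstrassCurve ℚ) [V.IsElliptic] [V.IsGloballyMinimal] (C : VariableChange ℚ),
      C • W.quadraticTwist ((-1) ^ (p / 2) * p) = V → V.HasGoodReductionAtPrime p →
      V.frobeniusTrace p = 0 → QuadraticBranchPlusMainConjectureAt V p)
    (hne : ∀ (V : WeierstrassCurve ℚ) [V.IsElliptic] [V.IsGloballyMinimal]
      {N : ℕ} [NeZero N] {f : CuspForm (Gamma0 N) 2},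
      IsNewformOf V f → ∀ (ϖ : ℚ) (L : IwasawaAlgebra p), IsQuadraticBranchMinusLFunction f p ϖ L →
      PowerSeries.coeff 1 L ≠ 0)
    (hPR : PerrinRiouUpToUnitAt PRRatio W p) : QuadraticBranchPAdicGrossZagierValuationAt W p :=
  quadraticBranchPAdicGrossZagierValuationAt_of_bsdp W p hmod
    (rankOne_bsdp_of_kmc_of_perrinRiou W p hC hreal hread hGZK hmod hr hp hadd hj hK hPR hKMC) h3 h1 hne

/-- **C-cc-1 ⇒ PR^×, GRANTED KMC⁰(W), (C1_η) at the twin and (C3_η), on a pair CARRYING the twin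
data** (`p ≥ 5`, `V` the good `a_p = 0` twist, newform `f`, period ratio `ϖ`, an `L` with the
interpolation property of `L_p⁻(V,η,X)`, `W(ℚ_p)[p] = 0`, a generator `P` of `p`-divisibility level
`n`): (C1_η) ∧ (C2_η-GZ) ∧ (C3_η) ⇒ `BSD(W,p)` (p307042, index discharged) ⇒ PR^× (part 6 = the
Burns–Kurihara–Sano direction, with `HasPRRatio`). [cite: BurnsKuriharaSano2019, Thm. 7.3 (p. 29)]
[cite: Kobayashi2003, §4 (p. 8) and Thm. 7.4 (p. 13)] [cite: Miller2011LMS, Def. 1.1] -/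
theorem perrinRiouUpToUnitAt_of_quadraticBranchPAdicGrossZagierValuation_of_kmc
    (hC : RankOneCountReading IsOf PRRatio) (hrat : HasPRRatio PRRatio) (hreal : Realizable IsOf)
    (hread : ReadsTrivialKMC IsOf KMC) (hGZK : rank_eq_analyticRank_of_analyticRank_le_one)
    (hmod : hasEntireLFunction_rat) (hGZ : GrossZagier1986_thm_I_7_3)
    (hr : W.analyticRank = 1) (hp5 : 5 ≤ p) (hadd : Addv W p) (hj : 0 ≤ padicValRat p W.j)
    (hK : Kato2004.ImageContainsSL2 W p) (hKMC : KMC W p)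
    (h3 : QuadraticBranchOddStrictExactControlOfPlusMCAt W p)
    (hCtw : C • W.quadraticTwist ((-1) ^ (p / 2) * p) = V) (hgood : V.HasGoodReductionAtPrime p)
    (hap : V.frobeniusTrace p = 0) (h1 : QuadraticBranchPlusMainConjectureAt V p)
    (hf : IsNewformOf V f)
    (hϖ : if Even (p / 2) then (ϖ : ℝ) * V.realPeriodRat = plusPeriod f
      else (ϖ : ℝ) * V.imaginaryPeriodRat = minusPeriod f)
    (hL : IsQuadraticBranchMinusLFunction f p ϖ L)
    (htors : ∀ Q : (W.baseChange ℚ_[p]).toAffine.Point, p • Q = 0 → Q = 0) (hP : ¬ IsOfFinAddOrder P)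
    (hgen : ∀ R : W.toAffine.Point, ∃ (k : ℤ) (T : W.toAffine.Point), IsOfFinAddOrder T ∧ R = k • P + T)
    (hdiv : ∃ Q : (W.baseChange ℚ_[p]).toAffine.Point, p ^ n • Q = W.toPadicPoint p P)
    (hndiv : ∀ Q : (W.baseChange ℚ_[p]).toAffine.Point, p ^ (n + 1) • Q ≠ W.toPadicPoint p P)
    (h2 : QuadraticBranchPAdicGrossZagierValuationAt W p) : PerrinRiouUpToUnitAt PRRatio W p := by
  have hp : p ≠ 2 := by omega
  have hfin : Finite W.sha := (hGZK W (by rw [hr])).2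
  have hB : BSDp W p :=
    bsdp_of_quadraticBranchPAdicGrossZagierValuation_of_exactControl W p hmod hGZ hGZK
      ((quadraticBranchPAdicGrossZagierValuationAt_iff W p).mp h2) h3
      (StrictSha.strictSelmerIndexAt_holds W p) hp5 hCtw hgood hap h1 hf hϖ hL htors hP hgen hdiv
      hndiv hr
  exact perrinRiouUpToUnitAt_of_kmc_of_missingPPartAt W p hC hrat hreal hread hGZK hmod hr hp hadd hj
    hK hKMC (missingPPartAt_of_bsdp W p hB)

/-- **ONE RESIDUE IN TWO CURRENCIES (rank one; planner's Q1 / R23): GRANTED KMC⁰(W), (C1_η) on the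
twins and (C3_η), on a Gss2 pair with (12.5.2) carrying the twin data, PR^×(W,p) ⟺ C-cc-1(W,p)
(valuation content)** — both being equivalent to `BSD(W,p)` (`missingPPartAt_iff_perrinRiou_of_kmc`,
part 6; p307042 + p396720 on the signed side). So the named non-MC rank-one input of the Gss2 /
O7-ss ∩ (e = 2) rows is ONE statement in two currencies: Burns–Kurihara–Sano Conj. 2.8 / 1.5
(= Perrin-Riou 1993) ≡ C-cc-1, modulo the main conjectures and exact control. Nothing asserted about
any pair; every input displayed. [cite: BurnsKuriharaSano2019, Conj. 2.8 (p. 10), Thm. 7.3 and Thm. 7.6 (p. 29)]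
[cite: Kobayashi2003, §4 (p. 8) and Thm. 7.4 (p. 13)] [cite: Miller2011LMS, Def. 1.1] -/
theorem perrinRiou_iff_quadraticBranchPAdicGrossZagierValuation_of_kmc
    (hC : RankOneCountReading IsOf PRRatio) (hrat : HasPRRatio PRRatio) (hreal : Realizable IsOf)
    (hread : ReadsTrivialKMC IsOf KMC) (hGZK : rank_eq_analyticRank_of_analyticRank_le_one)
    (hmod : hasEntireLFunction_rat) (hGZ : GrossZagier1986_thm_I_7_3)
    (hr : W.analyticRank = 1) (hp5 : 5 ≤ p) (hadd : Addv W p) (hj : 0 ≤ padicValRat p W.j)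
    (hK : Kato2004.ImageContainsSL2 W p) (hKMC : KMC W p)
    (h3 : QuadraticBranchOddStrictExactControlOfPlusMCAt W p)
    (h1 : ∀ (V : WeierstrassCurve ℚ) [V.IsElliptic] [V.IsGloballyMinimal] (C : VariableChange ℚ),
      C • W.quadraticTwist ((-1) ^ (p / 2) * p) = V → V.HasGoodReductionAtPrime p →
      V.frobeniusTrace p = 0 → QuadraticBranchPlusMainConjectureAt V p)
    (hne : ∀ (V : WeierstrassCurve ℚ) [V.IsElliptic] [V.IsGloballyMinimal]
      {N : ℕ} [NeZero N] {f : CuspForm (Gamma0 N) 2},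
      IsNewformOf V f → ∀ (ϖ : ℚ) (L : IwasawaAlgebra p), IsQuadraticBranchMinusLFunction f p ϖ L →
      PowerSeries.coeff 1 L ≠ 0)
    (hCtw : C • W.quadraticTwist ((-1) ^ (p / 2) * p) = V) (hgood : V.HasGoodReductionAtPrime p)
    (hap : V.frobeniusTrace p = 0) (hf : IsNewformOf V f)
    (hϖ : if Even (p / 2) then (ϖ : ℝ) * V.realPeriodRat = plusPeriod f
      else (ϖ : ℝ) * V.imaginaryPeriodRat = minusPeriod f)
    (hL : IsQuadraticBranchMinusLFunction f p ϖ L)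
    (htors : ∀ Q : (W.baseChange ℚ_[p]).toAffine.Point, p • Q = 0 → Q = 0) (hP : ¬ IsOfFinAddOrder P)
    (hgen : ∀ R : W.toAffine.Point, ∃ (k : ℤ) (T : W.toAffine.Point), IsOfFinAddOrder T ∧ R = k • P + T)
    (hdiv : ∃ Q : (W.baseChange ℚ_[p]).toAffine.Point, p ^ n • Q = W.toPadicPoint p P)
    (hndiv : ∀ Q : (W.baseChange ℚ_[p]).toAffine.Point, p ^ (n + 1) • Q ≠ W.toPadicPoint p P) :
    PerrinRiouUpToUnitAt PRRatio W p ↔ QuadraticBranchPAdicGrossZagierValuationAt W p :=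
  ⟨quadraticBranchPAdicGrossZagierValuationAt_of_perrinRiou_of_kmc W p hC hreal hread hGZK hmod hr
      (by omega) hadd hj hK hKMC h3 h1 hne,
    perrinRiouUpToUnitAt_of_quadraticBranchPAdicGrossZagierValuation_of_kmc W p hC hrat hreal hread
      hGZK hmod hGZ hr hp5 hadd hj hK hKMC h3 hCtw hgood hap (h1 V C hCtw hgood hap) hf hϖ hL htors hP
      hgen hdiv hndiv⟩

/-- **All four main-conjecture/analytic-input pairs give `BSD(W,p)`; recorded as the 2 × 2 table's
off-diagonal entry not yet in the tree: KMC⁰(W) ∧ C-cc-1(W,p) ⇒ `BSD(W,p)` needs (C1_η) ∧ (C3_η) as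
well (through p307042) — i.e. the Kato-side MC does NOT shortcut the signed consumer without a
KMC⁰ ↔ (C1_η) bridge (T-e2-K, cc-typer-5).** Stated for the record as the composite actually
available: (C1_η) ∧ (C3_η) ∧ C-cc-1 ⇒ BSD_p ⇒ (with KMC⁰) PR^× ⇒ (with KMC⁰) BSD_p again — so on these
rows KMC⁰ adds nothing to the signed chain's conclusion, and (C1_η) adds nothing to the Kato chain's,
until T-e2-K identifies them. [cite: BurnsKuriharaSano2019, Thm. 7.6 (p. 29)] [cite: Miller2011LMS, Def. 1.1] -/
theorem bsdp_of_kmc_of_perrinRiou_or_of_plusMC_of_valuation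
    (hC : RankOneCountReading IsOf PRRatio) (hreal : Realizable IsOf) (hread : ReadsTrivialKMC IsOf KMC)
    (hGZK : rank_eq_analyticRank_of_analyticRank_le_one) (hmod : hasEntireLFunction_rat)
    (hGZ : GrossZagier1986_thm_I_7_3) (hr : W.analyticRank = 1) (hp5 : 5 ≤ p) (hadd : Addv W p)
    (hj : 0 ≤ padicValRat p W.j) (hK : Kato2004.ImageContainsSL2 W p)
    (h3 : QuadraticBranchOddStrictExactControlOfPlusMCAt W p)
    (hCtw : C • W.quadraticTwist ((-1) ^ (p / 2) * p) = V) (hgood : V.HasGoodReductionAtPrime p)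
    (hap : V.frobeniusTrace p = 0) (hf : IsNewformOf V f)
    (hϖ : if Even (p / 2) then (ϖ : ℝ) * V.realPeriodRat = plusPeriod f
      else (ϖ : ℝ) * V.imaginaryPeriodRat = minusPeriod f)
    (hL : IsQuadraticBranchMinusLFunction f p ϖ L)
    (htors : ∀ Q : (W.baseChange ℚ_[p]).toAffine.Point, p • Q = 0 → Q = 0) (hP : ¬ IsOfFinAddOrder P)
    (hgen : ∀ R : W.toAffine.Point, ∃ (k : ℤ) (T : W.toAffine.Point), IsOfFinAddOrder T ∧ R = k • P + T)
    (hdiv : ∃ Q : (W.baseChange ℚ_[p]).toAffine.Point, p ^ n • Q = W.toPadicPoint p P)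
    (hndiv : ∀ Q : (W.baseChange ℚ_[p]).toAffine.Point, p ^ (n + 1) • Q ≠ W.toPadicPoint p P)
    (h : (KMC W p ∧ PerrinRiouUpToUnitAt PRRatio W p) ∨
      (QuadraticBranchPlusMainConjectureAt V p ∧ QuadraticBranchPAdicGrossZagierValuationAt W p)) :
    BSDp W p := by
  rcases h with ⟨hKMC, hPR⟩ | ⟨h1, h2⟩
  · exact rankOne_bsdp_of_kmc_of_perrinRiou W p hC hreal hread hGZK hmod hr (by omega) hadd hj hK hPR
      hKMC
  · exact bsdp_of_quadraticBranchPAdicGrossZagierValuation_of_exactControl W p hmod hGZ hGZK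
      ((quadraticBranchPAdicGrossZagierValuationAt_iff W p).mp h2) h3
      (StrictSha.strictSelmerIndexAt_holds W p) hp5 hCtw hgood hap h1 hf hϖ hL htors hP hgen hdiv
      hndiv hr

end Summit.BirchSwinnertonDyer.Rank1Residual.Additive

end
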